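import Summits.HodgeConjecture.HodgeConjecture.Theses.LinearSystemTorelli
import Literature.Barriers.HodgeConjecture.GeneralizedHodgeTrivialReasonsSubHodge
import Literature.AlgebraicGeometry.HodgeTheory.HodgeStructureOfHodgeModel
import Literature.AlgebraicGeometry.HodgeTheory.SupportedClassesRationalProofs
import Literature.AlgebraicGeometry.Motives.HodgeStructureSubstructures
import Summits.HodgeConjecture.HodgeConjecture.Theorems.LinearSystemTorelliTranscendentalOrSupportedStubPerpSubHodge

/-!
# Crux `TranscendentalOrSupported` (stmt-HodgeConjecture-10853), line `Sketch` (skeleton v4,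
# isotypic split) — stub `stub_bootstrap`: an irreducible rationally spanned sub-Hodge structure
# meeting `Nᶜ Hᵏ` non-trivially lies in `Nᶜ Hᵏ`

For `X` smooth projective of dimension `n` over `ℂ`, a Hodge model `A`, degrees `k`, `c`, and a
`ℂ`-subspace `W ⊆ Hᵏ(X(ℂ); ℂ)` which is spanned by its rational classes, whose pull-back to `A` is a
sub-Hodge structure (`W.map A^* = ⨁_{p+q=k} W.map A^* ∩ H^{p,q}`), and which is IRREDUCIBLE among
such subspaces (its only rationally spanned sub-Hodge subspaces are `⊥` and `W`): if
`W ∩ Nᶜ Hᵏ ≠ 0` for `Nᶜ Hᵏ = supportedClasses X k c`, then `W ⊆ Nᶜ Hᵏ` — GRANTED the named fact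
`Grothendieck1969_supportedClasses_isSubHodge` (Grothendieck 1969 p. 300 / Deligne, Hodge III
Cor. 8.2.8: the complex span of the rational classes of `Nᶜ Hᵏ` is a sub-Hodge structure), taken
as the hypothesis `hN`.

PROOF. `U := W ∩ Nᶜ Hᵏ` is again a rationally spanned sub-Hodge structure, `≤ W` and `≠ 0`, so
`U = W` by irreducibility:

* `Nᶜ Hᵏ` is the complex span of its rational classes (`supportedClasses_eq_span_isRationalClass`,
  proved in the tree), so `hN` says that `(Nᶜ Hᵏ).map A^*` is a sub-Hodge structure;
* **the intersection of two rationally spanned subspaces is rationally spanned**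
  (`bootstrap_inf_le_span_isRationalClass`, for ANY topological space `Y`): through the injective
  complexification `β : ℂ ⊗_ℚ Hᵏ(Y; ℚ) → Hᵏ(Y; ℂ)` (`ofRatClassBaseChange_injective`) a rationally
  spanned `V` is `β(K_V ⊗ ℂ)` for the `ℚ`-subspace `K_V = {a | a ⊗ 1 ∈ V}`, and
  `(K₁ ⊗ ℂ) ∩ (K₂ ⊗ ℂ) ⊆ (K₁ ∩ K₂) ⊗ ℂ` by flatness of `ℂ/ℚ` (`bootstrap_baseChange_inf_le`:
  `K₁ ∩ K₂ = ker (V → V/K₁ × V/K₂)` and base change commutes with kernels,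
  `HodgeStructure.mem_baseChange_ker_iff`); the classes `β(1 ⊗ a) = a ⊗ 1`, `a ∈ K₁ ∩ K₂`, are
  rational classes of `V₁ ∩ V₂`;
* **the intersection of two sub-Hodge structures is a sub-Hodge structure**: the Hodge components
  (`HodgeModel.exists_sum_eq_of_hodgeDecomposition`) of a class of `U` lie in `W` and in `Nᶜ Hᵏ`
  (`perpSubHodge_component_mem`, landed with stub `stub_perpSubHodge`), hence in `U`.

## References

* [GrothendieckTopology1969] A. Grothendieck, Hodge's general conjecture is false for trivial
  reasons, Topology 8 (1969), p. 300.
* [VoisinHodgeI2002] C. Voisin, Hodge Theory and Complex Algebraic Geometry I, CUP 2002, §7.1.1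
  (`Hᵏ(X, ℚ) ⊗ ℂ = Hᵏ(X, ℂ)`), §7.3.1 (sub-Hodge structures, Lemma 7.25 and the remark after
  Lemma 7.26).
* [HatcherAT2002] A. Hatcher, Algebraic Topology, CUP 2002, §3.1 p. 198.
-/

noncomputable section

-- `Summit.HodgeConjecture.HodgeConjecture.Theorems` is the mandated namespace (single-problem summit:
-- Problem = Summit), flagged by `linter.dupNamespace`; restated for stand-alone elaboration.
set_option linter.dupNamespace false

open scoped TensorProduct
open CategoryTheory
open Literature.AlgebraicGeometry.Motives Literature.AlgebraicGeometry.HodgeTheory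
open Literature.AlgebraicTopology.SingularHomology
-- `Finset.antidiagonal` alone resolves to the `Set.IsPWO` antidiagonal of `Data.Finset.MulAntidiagonal`
open Finset.HasAntidiagonal (antidiagonal mem_antidiagonal)

namespace Summit.HodgeConjecture.HodgeConjecture.Theorems

universe u

/-! ### Flat base change `ℚ → ℂ` and intersections -/

/-- **Base change to `ℂ` commutes with intersections** (the inclusion that needs flatness of
`ℂ/ℚ`): for `ℚ`-subspaces `K₁, K₂ ⊆ M`, `(K₁ ⊗ ℂ) ∩ (K₂ ⊗ ℂ) ⊆ (K₁ ∩ K₂) ⊗ ℂ` inside `ℂ ⊗_ℚ M`.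
Proof: `Kᵢ = ker (M → M/Kᵢ)`, `K₁ ∩ K₂ = ker (M → M/K₁ × M/K₂)`, and `x ∈ (ker f) ⊗ ℂ ↔ (f ⊗ ℂ) x = 0`
(`HodgeStructure.mem_baseChange_ker_iff`). [folklore] -/
theorem bootstrap_baseChange_inf_le {M : Type*} [AddCommGroup M] [Module ℚ M]
    (K₁ K₂ : Submodule ℚ M) :
    K₁.baseChange ℂ ⊓ K₂.baseChange ℂ ≤ (K₁ ⊓ K₂).baseChange ℂ := by
  intro x hx
  obtain ⟨h1, h2⟩ := Submodule.mem_inf.1 hx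
  rw [← Submodule.ker_mkQ K₁, HodgeStructure.mem_baseChange_ker_iff] at h1
  rw [← Submodule.ker_mkQ K₂, HodgeStructure.mem_baseChange_ker_iff] at h2
  rw [← Submodule.ker_mkQ K₁, ← Submodule.ker_mkQ K₂, ← LinearMap.ker_prod,
    HodgeStructure.mem_baseChange_ker_iff]
  have hprod : K₁.mkQ.prod K₂.mkQ =
      (LinearMap.inl ℚ _ _ ∘ₗ K₁.mkQ) + (LinearMap.inr ℚ _ _ ∘ₗ K₂.mkQ) := by
    ext v <;> simp
  rw [hprod, LinearMap.baseChange_add, LinearMap.add_apply, LinearMap.baseChange_comp,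
    LinearMap.baseChange_comp, LinearMap.comp_apply, LinearMap.comp_apply, h1, h2, map_zero,
    map_zero, add_zero]

/-! ### The intersection of two rationally spanned subspaces is rationally spanned -/

/-- **The intersection of two complex subspaces spanned by rational classes is spanned by its
rational classes.** For a topological space `Y` and `ℂ`-subspaces `V₁, V₂ ⊆ Hᵏ(Y; ℂ)`, each
contained in the span of its rational classes (`IsRationalClass`): `V₁ ∩ V₂` is contained in the
span of ITS rational classes. Through the injective complexification
`β : ℂ ⊗_ℚ Hᵏ(Y; ℚ) → Hᵏ(Y; ℂ)`, `c ⊗ a ↦ c • (a ⊗ 1)` (`ofRatClassBaseChange_injective`; Voisin I,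
§7.1.1): `Vᵢ ⊆ β(Kᵢ ⊗ ℂ)` for `Kᵢ = {a | a ⊗ 1 ∈ Vᵢ}`, so
`V₁ ∩ V₂ ⊆ β((K₁ ⊗ ℂ) ∩ (K₂ ⊗ ℂ)) ⊆ β((K₁ ∩ K₂) ⊗ ℂ)` (`bootstrap_baseChange_inf_le`), which is
spanned by the rational classes `a ⊗ 1`, `a ∈ K₁ ∩ K₂`, of `V₁ ∩ V₂`.
[cite: VoisinHodgeI2002, §7.1.1] -/
theorem bootstrap_inf_le_span_isRationalClass {Y : Type u} [TopologicalSpace Y] (k : ℕ)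
    {V₁ V₂ : Submodule ℂ (singularCohomology ℂ ℂ Y k)}
    (h₁ : V₁ ≤ Submodule.span ℂ {x | x ∈ V₁ ∧ IsRationalClass x})
    (h₂ : V₂ ≤ Submodule.span ℂ {x | x ∈ V₂ ∧ IsRationalClass x}) :
    V₁ ⊓ V₂ ≤ Submodule.span ℂ {x | x ∈ V₁ ⊓ V₂ ∧ IsRationalClass x} := by
  -- the rational points `K V = {a | a ⊗ 1 ∈ V}` of a complex subspace `V`
  let K : Submodule ℂ (singularCohomology ℂ ℂ Y k) → Submodule ℚ (singularCohomology ℚ ℚ Y k) :=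
    fun V ↦ ((V.comap (ofRatClassBaseChange Y k)).restrictScalars ℚ).comap
      (TensorProduct.mk ℚ ℂ (singularCohomology ℚ ℚ Y k) 1)
  have hK : ∀ (V : Submodule ℂ (singularCohomology ℂ ℂ Y k)) (a : singularCohomology ℚ ℚ Y k),
      a ∈ K V ↔ ofRatClass Y k a ∈ V := fun V a ↦ by
    show ofRatClassBaseChange Y k ((1 : ℂ) ⊗ₜ[ℚ] a) ∈ V ↔ _
    rw [ofRatClassBaseChange_tmul, one_smul]
  -- a subspace spanned by rational classes lies in `β (K V ⊗ ℂ)`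
  have hle : ∀ V : Submodule ℂ (singularCohomology ℂ ℂ Y k),
      V ≤ Submodule.span ℂ {x | x ∈ V ∧ IsRationalClass x} →
      V ≤ ((K V).baseChange ℂ).map (ofRatClassBaseChange Y k) := by
    intro V hV
    refine hV.trans (Submodule.span_le.2 ?_)
    rintro x ⟨hxV, hxr⟩
    obtain ⟨a, rfl⟩ := (isRationalClass_iff_mem_range_ofRatClass x).1 hxr
    exact ⟨(1 : ℂ) ⊗ₜ[ℚ] a, Submodule.tmul_mem_baseChange_of_mem 1 ((hK V a).2 hxV),
      by rw [ofRatClassBaseChange_tmul, one_smul]⟩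
  -- `β ((K V₁ ∩ K V₂) ⊗ ℂ)` is spanned by rational classes of `V₁ ∩ V₂`
  have hge : ((K V₁ ⊓ K V₂).baseChange ℂ).map (ofRatClassBaseChange Y k) ≤
      Submodule.span ℂ {x | x ∈ V₁ ⊓ V₂ ∧ IsRationalClass x} := by
    rw [Submodule.baseChange_eq_span, Submodule.map_span, Submodule.span_le]
    rintro _ ⟨_, ⟨a, ha, rfl⟩, rfl⟩
    rw [SetLike.mem_coe, TensorProduct.mk_apply, ofRatClassBaseChange_tmul, one_smul]
    exact Submodule.subset_span ⟨⟨(hK V₁ a).1 ha.1, (hK V₂ a).1 ha.2⟩, isRationalClass_ofRatClass a⟩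
  calc V₁ ⊓ V₂ ≤ ((K V₁).baseChange ℂ).map (ofRatClassBaseChange Y k) ⊓
        ((K V₂).baseChange ℂ).map (ofRatClassBaseChange Y k) := inf_le_inf (hle V₁ h₁) (hle V₂ h₂)
    _ = ((K V₁).baseChange ℂ ⊓ (K V₂).baseChange ℂ).map (ofRatClassBaseChange Y k) :=
        (Submodule.map_inf _ (ofRatClassBaseChange_injective Y k)).symm
    _ ≤ ((K V₁ ⊓ K V₂).baseChange ℂ).map (ofRatClassBaseChange Y k) :=
        Submodule.map_mono (bootstrap_baseChange_inf_le _ _)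
    _ ≤ _ := hge

/-! ### The stub -/

/-- **Isotypic bootstrap** (stub `stub_bootstrap` of the line `Sketch`, skeleton v4, of the crux
`TranscendentalOrSupported`): for `X` smooth projective of dimension `n`, a Hodge model `A`, degrees
`k`, `c`, and an IRREDUCIBLE rationally spanned sub-Hodge structure `W ⊆ Hᵏ(X(ℂ); ℂ)` (its only
rationally spanned sub-Hodge subspaces are `⊥` and `W`) meeting `Nᶜ Hᵏ = supportedClasses X k c`
non-trivially, `W ≤ Nᶜ Hᵏ` — granted the named fact `Grothendieck1969_supportedClasses_isSubHodge`
(`hN`: the span of the rational classes of `Nᶜ Hᵏ`, pulled back to `A`, is a sub-Hodge structure;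
Grothendieck 1969 p. 300, Deligne Hodge III Cor. 8.2.8). Proof: `Nᶜ Hᵏ` is the span of its
rational classes (`supportedClasses_eq_span_isRationalClass`), so `U := W ∩ Nᶜ Hᵏ` is rationally
spanned (`bootstrap_inf_le_span_isRationalClass`) and a sub-Hodge structure (the Hodge components of
a class of `U` stay in `W` and in `Nᶜ Hᵏ`, `perpSubHodge_component_mem`); it is `≤ W` and `≠ ⊥`,
hence `= W` by irreducibility. [cite: GrothendieckTopology1969, p. 300]
[cite: VoisinHodgeI2002, §7.3.1 (Lemma 7.25 and the remark after Lemma 7.26)] -/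
theorem stub_bootstrap
    (hN : Literature.Barriers.HodgeConjecture.Grothendieck1969_supportedClasses_isSubHodge) :
    ∀ ⦃n : ℕ⦄ ⦃X : SchemeOver ℂ⦄ (hX : IsSmoothProjective n X) (A : HodgeModel n X) (k c : ℕ)
    (W : Submodule ℂ (complexBetti X k)),
    Submodule.span ℂ {x : complexBetti X k | x ∈ W ∧ IsRationalClass x} = W →
    W.map (A.pullback k).hom =
      ⨆ (p' : ℕ) (q' : ℕ) (_ : p' + q' = k), W.map (A.pullback k).hom ⊓ A.hodgePQ k p' q' →
    (∀ V : Submodule ℂ (complexBetti X k), V ≤ W →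
      Submodule.span ℂ {x : complexBetti X k | x ∈ V ∧ IsRationalClass x} = V →
      V.map (A.pullback k).hom =
        ⨆ (p' : ℕ) (q' : ℕ) (_ : p' + q' = k), V.map (A.pullback k).hom ⊓ A.hodgePQ k p' q' →
      V = ⊥ ∨ V = W) →
    W ⊓ supportedClasses X k c ≠ ⊥ →
    W ≤ supportedClasses X k c := by
  intro n X hX A k c W hrat hsub hirr hne
  -- `Nᶜ Hᵏ` lies in the span of its rational classes ...
  have hNrat : supportedClasses X k c ≤ Submodule.span ℂ
      {x : complexBetti X k | x ∈ supportedClasses X k c ∧ IsRationalClass x} :=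
    (supportedClasses_le_span_isRationalClass hX k c).trans
      (Submodule.span_mono fun x hx ↦ ⟨hx.2, hx.1⟩)
  -- ... and its pull-back to `A` is a sub-Hodge structure (`hN`)
  have hNsub : (supportedClasses X k c).map (A.pullback k).hom =
      ⨆ (p' : ℕ) (q' : ℕ) (_ : p' + q' = k),
        (supportedClasses X k c).map (A.pullback k).hom ⊓ A.hodgePQ k p' q' := by
    have h := hN n X hX A k c
    rw [← supportedClasses_eq_span_isRationalClass hX k c] at h
    exact h
  -- `U := W ⊓ Nᶜ Hᵏ` is spanned by its rational classes ...
  have hUrat : Submodule.span ℂ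
      {x : complexBetti X k | x ∈ W ⊓ supportedClasses X k c ∧ IsRationalClass x} =
        W ⊓ supportedClasses X k c :=
    le_antisymm (Submodule.span_le.2 fun x hx ↦ hx.1)
      (bootstrap_inf_le_span_isRationalClass k hrat.ge hNrat)
  -- ... and its pull-back to `A` is a sub-Hodge structure
  have hUsub : (W ⊓ supportedClasses X k c).map (A.pullback k).hom =
      ⨆ (p' : ℕ) (q' : ℕ) (_ : p' + q' = k),
        (W ⊓ supportedClasses X k c).map (A.pullback k).hom ⊓ A.hodgePQ k p' q' := by
    refine (A.isSubHodge_iff_le k _).2 ?_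
    rintro _ ⟨u, ⟨huW, huN⟩, rfl⟩
    obtain ⟨z, hz, hzt⟩ := A.exists_sum_eq_of_hodgeDecomposition k u
    have hzW := perpSubHodge_component_mem A hsub huW hz hzt
    have hzN := perpSubHodge_component_mem A hNsub huN hz hzt
    have hsum : (A.pullback k).hom u = ∑ i ∈ antidiagonal k, (A.pullback k).hom (z i) := by
      rw [← map_sum, hz]
    rw [hsum]
    refine Submodule.sum_mem _ fun i hi ↦ ?_
    exact Submodule.mem_iSup_of_mem i.1 (Submodule.mem_iSup_of_mem i.2
      (Submodule.mem_iSup_of_mem (mem_antidiagonal.1 hi)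
        ⟨Submodule.mem_map_of_mem ⟨hzW i hi, hzN i hi⟩, hzt i hi⟩))
  -- irreducibility: `U = ⊥` is excluded, so `U = W`, i.e. `W ≤ Nᶜ Hᵏ`
  rcases hirr _ inf_le_left hUrat hUsub with h | h
  · exact absurd h hne
  · exact inf_eq_left.1 h

end Summit.HodgeConjecture.HodgeConjecture.Theorems

end
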